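/-
Copyright (c) 2026 the pub-hodgecm-mathlib formalisation cell (harness21).  Prover seat hodgecm-mathlib-LH10-p01 (g10): road «M6 ∕ F3 TOT-Λ BY OVER-ORDERS»
(LEAD T14-66; SIG-F3-5 v1 6925585c (S3) carve (c7) «orders of `K₂` are `σ`-stable», orphaned by LH7-p04 (g11)'s closure), 2026-09-03: the `hordσ` binder of ★ F3-2b
`SelfDualOverOrderPartition` discharged in the valued quadratic frame with a `σ_K`-fixed integral generator.
-/
import Literature.NumberTheory.Automorphic.GluedLatticeCyclic       -- ★ (O4-G) FILE 1 (LH7-p04 (g11)): `pointwise_smul_le_iff_forall`; brings the `Pointwise` action of `K` on `Submodule 𝒪[E] K`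
import Literature.NumberTheory.Automorphic.OverOrderIntegralReading  -- ★ (c4) p853025 (this seat): `span_integer_subset_span_integer` (the `𝒪_E ⊆ 𝒪_K` span comparison); brings ★ (D3)'s two-valued-fields frame
import HarnessLib

/-!
# Multiplier-stable lattices in a valued quadratic extension are `σ_K`-multiplier-stable (`hordσ`)

Topic `NumberTheory/Automorphic`; namespace `Literature.NumberTheory.Automorphic`.  THEOREMS ONLY (no definition, no instance, no notation, no named fact, no `sorry`).
Cell `pub/hodgecm-mathlib` (D-0151), crux H413 = `stmt-HodgeConjecture-24833`; road M6 → F3 «TOT-Λ by over-orders».  ★ F3-2b `exists_subring_span_image_eq_of_selfDual` ∕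
`setOf_selfDual_stable_eq_biUnion` ∕ `ncard_setOf_selfDual_stable_eq_finsum` carry the binder
`hordσ : ∀ L : Submodule 𝒪[E] K, L.FG → ∀ c : K, c • L ≤ L → σK c • L ≤ L` («every multiplier of a finitely generated `𝒪_E`-lattice of `K` stays a multiplier after `σ_K`»).
This file proves it when `E ⊆ K` are valued fields (`algebraMap` integral), `K = E ⊕ E·θ` with an INTEGRAL BASIS `(1, θ)` of `𝒪_K` over `𝒪_E` (`hint`), and `σ_K` is a ring map
over an isometric `σ : E → E` FIXING `θ` — the frame of every ★ eigen-field package (`θ = √d`, `(α−1)∕ϖ^k`, …; `s′ θ = θ`, `s′ ∘ ι = ι ∘ s`, `|s x| = |x|`).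

THE MATHEMATICS.  Let `L ≠ 0` be finitely generated with `cL ⊆ L`.  (1) `c` is integral over `𝒪_K` (it stabilises the non-zero finitely generated `𝒪_K`-span of `L`;
determinant trick), so `c ∈ 𝒪_K = 𝒪_E ⊕ 𝒪_E θ`: `c = p + qθ`, `p, q ∈ 𝒪_E`.  (2) The multiplier set `O(L) = {x | xL ⊆ L}` contains `𝒪_E` (scalars) and is closed under `+`, `·`;
so `qθ = c − p ∈ O(L)`.  (3) `σ_K c = σp + σq·θ` with `σp ∈ 𝒪_E ⊆ O(L)` and `σq·θ = (σq∕q)·(qθ)` where `σq∕q ∈ 𝒪_E` is a UNIT (`|σq| = |q|`) — so `σ_K c ∈ O(L)`.  (`L = 0` is trivial.)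

* §1 `mem_integer_of_smul_le` (multipliers are integral), `mul_smul_le_of_smul_le` ∕ `add_smul_le_of_smul_le` ∕ `algebraMap_smul_le` (the multiplier set is an `𝒪_E`-algebra).
* §2 **`sigma_smul_le_of_smul_le`** — the `hordσ` binder, and its `∀`-packaged form **`forall_sigma_smul_le_of_smul_le`** (★ F3-2b's literal hypothesis).

References: [Neukirch1999] J. Neukirch, *Algebraic Number Theory*, Grundlehren 322 (1999), Ch. I §12 (orders of a quadratic extension: `𝒪_E + 𝔣𝒪_K`, Galois-stable);
[AtiyahMacdonald1969] M. Atiyah, I. Macdonald, *Introduction to Commutative Algebra* (1969), Prop. 2.4, Prop. 5.1 (determinant trick), Prop. 5.18 (iii) (valuation rings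
are integrally closed); [SerreLocalFields1979] J.-P. Serre, *Local Fields*, GTM 67 (1979), Ch. I §6 (integral bases of totally ramified extensions); [Jacobowitz1962]
R. Jacobowitz, *Hermitian forms over local fields*, Amer. J. Math. 84 (1962), §7 (multiplier orders of hermitian lattices).
-/

set_option autoImplicit false

noncomputable section

open scoped ValuativeRel Pointwise
open ValuativeRel

namespace Literature.NumberTheory.Automorphic

variable {E : Type*} [Field E] [ValuativeRel E] {K : Type*} [Field K] [ValuativeRel K] [Algebra E K]

/-! ## §1 Multipliers of a lattice: integral, and an `𝒪_E`-algebra -/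

/-- **MULTIPLIERS ARE INTEGRAL**: if `c • L ⊆ L` for a non-zero finitely generated `𝒪_E`-submodule `L ≤ K` (and `algebraMap E K` maps `𝒪_E` into `𝒪_K`) then `c ∈ 𝒪_K` —
`c` stabilises the `𝒪_K`-span of a generating set (determinant trick; `𝒪_K` integrally closed). [cite: AtiyahMacdonald1969, Prop. 2.4, Prop. 5.1, Prop. 5.18 (iii)] -/
theorem mem_integer_of_smul_le (hOK : ∀ r : 𝒪[E], algebraMap E K (r : E) ∈ 𝒪[K]) (L : Submodule 𝒪[E] K) (hfg : L.FG) (hL : L ≠ ⊥)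
    (c : K) (hc : c • L ≤ L) : c ∈ 𝒪[K] := by
  classical
  obtain ⟨G, hG⟩ := hfg
  set N : Submodule 𝒪[K] K := Submodule.span 𝒪[K] (G : Set K) with hN
  have hsub : (L : Set K) ⊆ (N : Set K) := by
    rw [← hG]
    exact span_integer_subset_span_integer hOK _
  have hNbot : N ≠ ⊥ := by
    intro h
    apply hL
    rw [eq_bot_iff]
    intro x hx
    have := hsub hx
    rw [h] at this
    exact this
  have hNfg : N.FG := Submodule.fg_span G.finite_toSet
  have hGL : ∀ g ∈ (G : Set K), g ∈ L := fun g hg => by rw [← hG]; exact Submodule.subset_span hg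
  have hcL : ∀ x ∈ L, c • x ∈ L := (pointwise_smul_le_iff_forall c L L).1 hc
  have hstab : ∀ n ∈ N, c • n ∈ N := by
    have hle : N.map (LinearMap.mulLeft 𝒪[K] c) ≤ N := by
      rw [hN, Submodule.map_span_le]
      rintro g hg
      exact hsub (hcL g (hGL g hg))
    intro n hn
    exact hle ⟨n, hn, rfl⟩
  exact Valuation.Integers.mem_of_integral (Valuation.integer.integers (valuation K)) (isIntegral_of_smul_mem_submodule N hNbot hNfg c hstab)

omit [ValuativeRel K] in
/-- The multiplier set is closed under products. [cite: Jacobowitz1962, §7] -/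
theorem mul_smul_le_of_smul_le (L : Submodule 𝒪[E] K) {c c' : K} (hc : c • L ≤ L) (hc' : c' • L ≤ L) : (c * c') • L ≤ L := by
  rw [pointwise_smul_le_iff_forall] at hc hc' ⊢
  intro x hx
  rw [mul_smul]
  exact hc _ (hc' x hx)

omit [ValuativeRel K] in
/-- The multiplier set is closed under sums. [cite: Jacobowitz1962, §7] -/
theorem add_smul_le_of_smul_le (L : Submodule 𝒪[E] K) {c c' : K} (hc : c • L ≤ L) (hc' : c' • L ≤ L) : (c + c') • L ≤ L := by
  rw [pointwise_smul_le_iff_forall] at hc hc' ⊢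
  intro x hx
  rw [add_smul]
  exact L.add_mem (hc x hx) (hc' x hx)

omit [ValuativeRel K] in
/-- The multiplier set is closed under negation. [cite: Jacobowitz1962, §7] -/
theorem neg_smul_le_of_smul_le (L : Submodule 𝒪[E] K) {c : K} (hc : c • L ≤ L) : (-c) • L ≤ L := by
  rw [pointwise_smul_le_iff_forall] at hc ⊢
  intro x hx
  rw [neg_smul]
  exact L.neg_mem (hc x hx)

omit [ValuativeRel K] in
/-- Scalars from `𝒪_E` are multipliers: `(algebraMap E K r) • L ⊆ L` (`L` is an `𝒪_E`-module). [cite: Jacobowitz1962, §7] -/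
theorem algebraMap_smul_le (L : Submodule 𝒪[E] K) (r : 𝒪[E]) : (algebraMap E K (r : E)) • L ≤ L := by
  rw [pointwise_smul_le_iff_forall]
  intro x hx
  have h : algebraMap E K (r : E) • x = r • x := by
    rw [smul_eq_mul, ← Algebra.smul_def]; rfl
  rw [h]
  exact L.smul_mem r hx

/-! ## §2 `σ_K`-stability of the multipliers (`hordσ`) -/

/-- **`hordσ` — MULTIPLIERS STAY MULTIPLIERS AFTER `σ_K`.**  Frame: `algebraMap E K` integral on `𝒪_E`; an integral basis `(1, θ)`: every `z ∈ 𝒪_K` is `p + qθ` with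
`p, q ∈ 𝒪_E` (`hcoordO`); `σ_K : K →+* K` over an isometric `σ : E →+* E` (`σ_K ∘ algebraMap = algebraMap ∘ σ`, `|σ x| = |x|`) FIXING `θ`.  Then for every finitely
generated `𝒪_E`-submodule `L ≤ K` and every `c` with `c • L ⊆ L`: `σ_K c • L ⊆ L`.  (`c = p + qθ ∈ 𝒪_K` by §1; `qθ = c − p` is a multiplier; `σ_K c = σp + (σq∕q)·(qθ)` with
`σq∕q ∈ 𝒪_E`.) [cite: Neukirch1999, Ch. I §12] [cite: AtiyahMacdonald1969, Prop. 5.1] [cite: Jacobowitz1962, §7] -/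
theorem sigma_smul_le_of_smul_le (hOK : ∀ r : 𝒪[E], algebraMap E K (r : E) ∈ 𝒪[K]) (σ : E →+* E) (σK : K →+* K)
    (hσK : ∀ x : E, σK (algebraMap E K x) = algebraMap E K (σ x)) (hσv : ∀ x : E, valuation E (σ x) = valuation E x)
    (θ : K) (hσKθ : σK θ = θ)
    (hcoordO : ∀ z : K, z ∈ 𝒪[K] → ∃ p q : E, p ∈ 𝒪[E] ∧ q ∈ 𝒪[E] ∧ z = algebraMap E K p + algebraMap E K q * θ)
    (L : Submodule 𝒪[E] K) (hfg : L.FG) (c : K) (hc : c • L ≤ L) : σK c • L ≤ L := by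
  classical
  by_cases hL : L = ⊥
  · rw [hL, pointwise_smul_le_iff_forall]
    intro x hx
    rw [(Submodule.mem_bot _).1 hx, smul_zero]
    exact Submodule.zero_mem _
  -- (1) `c = p + qθ` with `p, q ∈ 𝒪_E`
  obtain ⟨p, q, hp, hq, hcpq⟩ := hcoordO c (mem_integer_of_smul_le hOK L hfg hL c hc)
  -- (2) `qθ = c − p` is a multiplier
  have hpL : (algebraMap E K p) • L ≤ L := algebraMap_smul_le L ⟨p, hp⟩
  have hqθ : (algebraMap E K q * θ) • L ≤ L := by
    have h : algebraMap E K q * θ = c + -(algebraMap E K p) := by rw [hcpq]; ring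
    rw [h]
    exact add_smul_le_of_smul_le L hc (neg_smul_le_of_smul_le L hpL)
  -- (3) `σ_K c = σp + (σq/q)·(qθ)`
  have hσp : (algebraMap E K (σ p)) • L ≤ L := by
    have hσpO : σ p ∈ 𝒪[E] := by rw [Valuation.mem_integer_iff, hσv]; exact (Valuation.mem_integer_iff _ _).1 hp
    exact algebraMap_smul_le L ⟨σ p, hσpO⟩
  have hσc : σK c = algebraMap E K (σ p) + algebraMap E K (σ q) * θ := by
    rw [hcpq, map_add, map_mul, hσK, hσK, hσKθ]
  by_cases hq0 : q = 0
  · rw [hσc, hq0, map_zero, map_zero, zero_mul, add_zero]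
    exact hσp
  · -- `σq/q` is an integer (a unit, in fact)
    have hrO : σ q / q ∈ 𝒪[E] := by
      rw [Valuation.mem_integer_iff, map_div₀, hσv, div_self ((Valuation.ne_zero_iff _).2 hq0)]
    have hσqθ : (algebraMap E K (σ q) * θ) • L ≤ L := by
      have h : algebraMap E K (σ q) * θ = algebraMap E K (σ q / q) * (algebraMap E K q * θ) := by
        rw [← mul_assoc, ← map_mul, div_mul_cancel₀ _ hq0]
      rw [h]
      exact mul_smul_le_of_smul_le L (algebraMap_smul_le L ⟨σ q / q, hrO⟩) hqθ
    rw [hσc]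
    exact add_smul_le_of_smul_le L hσp hσqθ

/-- **`hordσ` PACKAGED** as ★ F3-2b's literal binder `∀ L : Submodule 𝒪[E] K, L.FG → ∀ c : K, c • L ≤ L → σK c • L ≤ L`. [cite: Neukirch1999, Ch. I §12] [cite: Jacobowitz1962, §7] -/
theorem forall_sigma_smul_le_of_smul_le (hOK : ∀ r : 𝒪[E], algebraMap E K (r : E) ∈ 𝒪[K]) (σ : E →+* E) (σK : K →+* K)
    (hσK : ∀ x : E, σK (algebraMap E K x) = algebraMap E K (σ x)) (hσv : ∀ x : E, valuation E (σ x) = valuation E x)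
    (θ : K) (hσKθ : σK θ = θ)
    (hcoordO : ∀ z : K, z ∈ 𝒪[K] → ∃ p q : E, p ∈ 𝒪[E] ∧ q ∈ 𝒪[E] ∧ z = algebraMap E K p + algebraMap E K q * θ) :
    ∀ L : Submodule 𝒪[E] K, L.FG → ∀ c : K, c • L ≤ L → σK c • L ≤ L :=
  fun L hfg c hc => sigma_smul_le_of_smul_le hOK σ σK hσK hσv θ hσKθ hcoordO L hfg c hc

omit [ValuativeRel E] in
/-- The integral-basis hypothesis `hcoordO` from the currency of the ★ eigen-field packages: unique coordinates on `(1, θ)` plus the integrality reading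
`p + qθ ∈ 𝒪_K ↔ p ∈ 𝒪_E ∧ q ∈ 𝒪_E`. [cite: SerreLocalFields1979, Ch. I §6] -/
theorem exists_integer_coord_of_int {S : Set E} (θ : K)
    (hcoord : ∀ z : K, ∃! pq : E × E, z = algebraMap E K pq.1 + algebraMap E K pq.2 * θ)
    (hint : ∀ p q : E, algebraMap E K p + algebraMap E K q * θ ∈ 𝒪[K] ↔ p ∈ S ∧ q ∈ S) (z : K) (hz : z ∈ 𝒪[K]) :
    ∃ p q : E, p ∈ S ∧ q ∈ S ∧ z = algebraMap E K p + algebraMap E K q * θ := by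
  obtain ⟨⟨p, q⟩, hzpq, -⟩ := hcoord z
  have h := (hint p q).1 (hzpq ▸ hz)
  exact ⟨p, q, h.1, h.2, hzpq⟩

end Literature.NumberTheory.Automorphic

end
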